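import Summits.ResolutionOfSingularities.ResolutionOfSingularities.Theorems.WeightedInvariantELadderTwoOrbitGenericFibre
import Summits.ResolutionOfSingularities.ResolutionOfSingularities.Theorems.WeightedInvariantELadderOneRegOfDim
import Summits.ResolutionOfSingularities.ResolutionOfSingularities.Theorems.WeightedInvariantSingularLocusHomogeneous
import Literature.AlgebraicGeometry.Resolution.GermsOfClosedSubsets
import HarnessLib

/-!
# Rung `e = 2`: `genSing₂` IS NON-EMPTY on a non-regular stage with (I0)₂

Route `ResolutionOfSingularities/WeightedInvariant`, door crux `HypersurfaceCentreConstruction`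
(stmt-ResolutionOfSingularities-19897), E2 tier, piece (C-a) `E2MaxNonemptyBody` of the registrar's SPEC (Δ9)
(ORDER (o47-a), res-D-pv-031), steps (α) «an orbit-generic point in the non-regular image» and (β) = the
registrar's U6 «orbit-generic points of the non-regular image have ambient stalk of dimension `≤ 3` under
(I0)₂».  OURS bookkeeping of the e-ladder; nothing here is a statement of [Hironaka2017]; AI-written, weaker than
expert review.

* `Stage.exists_isClosed_not_isRegularLocalRing` — a non-regular `X` (locally of finite type over `k`, hence
  Jacobson) has a CLOSED non-regular point (the non-regular locus is closed, Matsumura 30.5 Cor.);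
* `Stage.isClosed_singleton_q` — `q` sends closed points of `X` to closed points of `V` (Mathlib, Stacks 01TB);
* `Stage.mem_singImage_of_isOrbitGeneric_of_specializes` — **a torus-stable closed set through a point of a
  closed orbit contains the orbit**: if `η` is orbit-generic and specialises to a point of `singImage`, then
  `η ∈ singImage` (on a unit chart: `𝓘(Sing)(W) + 𝔭(η)` is homogeneous over the graded-simple `𝔭(η)`, so it is
  `𝔭(η)` or `⊤` — res-type-047's `eq_or_eq_top_of_isHomogeneous_of_gradedSimple` with res-type-025's
  `vanishingIdeal_singSet_isHomogeneous`);
* `Stage.exists_isOrbitGeneric_mem_singImage` — **(α)**: for `X` not regular there is an ORBIT-GENERIC point in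
  `singImage` (a maximal point of the fibre of `q` over `q s`, `s` a closed non-regular point, above `i s`;
  orbit-generic by `isOrbitGeneric_of_mem_maxPoints_fibre`);
* `Stage.ringKrullDim_stalk_le_three_of_isOrbitGeneric` — **(β) = U6**: under (I0)₂ `dim X = j + 2`, at an
  orbit-generic `η = i x ∈ singImage`: `dim closure {η} ≥ j` (unit chart, `TorusChartDim.le_ringKrullDim_quotient`),
  so `dim 𝒪_{X,x} = coheight x ≤ 2` and `dim 𝒪_{Y,η} = dim 𝒪_{X,x} + 1 ≤ 3` (local equation, Stacks 00KW) — the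
  rung-1 pattern of `Stage.invReg_of_invDim`;
* `Stage.genSing₂_nonempty` — **`S.InvDim₂ → ¬ IsRegular S.X → S.genSing₂.Nonempty`**.
-/

noncomputable section

set_option linter.dupNamespace false -- mandated namespace of this single-conjunct summit

open CategoryTheory AlgebraicGeometry TopologicalSpace IsLocalRing
open Literature.AlgebraicGeometry.Resolution
open Summit.ResolutionOfSingularities.ResolutionOfSingularities.Theorems
open Summit.ResolutionOfSingularities.ResolutionOfSingularities.Cruxes.HypersurfaceCentreConstruction.LocalEngine

namespace Summit.ResolutionOfSingularities.ResolutionOfSingularities.Theorems.ELadderOne.Stage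

variable {k : Type} [Field k] (S : Stage k)

/-! ## Closed non-regular points and their images in the quotient -/

/-- **A non-regular `X` has a CLOSED non-regular point** (`X` is locally of finite type over `k`, so Jacobson,
and its non-regular locus is closed). [folklore] -/
theorem exists_isClosed_not_isRegularLocalRing (hreg : ¬ Scheme.IsRegular S.X) :
    ∃ s : S.X, IsClosed ({s} : Set S.X) ∧ ¬ IsRegularLocalRing (S.X.presheaf.stalk s) := by
  haveI : JacobsonSpace S.X := LocallyOfFiniteType.jacobsonSpace (S.i ≫ S.f)
  have hopen : IsOpen (Scheme.regularLocus S.X) := isOpen_regularLocus_of_locallyOfFiniteType_field (S.i ≫ S.f)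
  have hne : ((Scheme.regularLocus S.X)ᶜ).Nonempty := by
    by_contra h
    rw [Set.not_nonempty_iff_eq_empty, Set.compl_empty_iff] at h
    exact hreg fun x => (Set.eq_univ_iff_forall.mp h x : x ∈ Scheme.regularLocus S.X)
  obtain ⟨s, hs, hsc⟩ := nonempty_inter_closedPoints hne hopen.isClosed_compl.isLocallyClosed
  exact ⟨s, hsc, hs⟩

/-- `q : X → V` is locally of finite type (`q ≫ g = i ≫ f` is). [folklore] -/
theorem locallyOfFiniteType_q : LocallyOfFiniteType S.q := by
  haveI : LocallyOfFiniteType (S.q ≫ S.g) := by rw [S.hq]; infer_instance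
  exact locallyOfFiniteType_of_comp S.q S.g

/-- **`q` sends closed points of `X` to closed points of `V`** (both locally of finite type over `k`;
Stacks 01TB). [folklore] -/
theorem isClosed_singleton_q {s : S.X} (hs : IsClosed ({s} : Set S.X)) :
    IsClosed ({S.q.base s} : Set S.V) := by
  haveI : JacobsonSpace S.V := LocallyOfFiniteType.jacobsonSpace S.g
  haveI := S.locallyOfFiniteType_q
  exact S.q.closePoints_subset_preimage_closedPoints hs

/-- A non-regular point of `X` maps into `singImage (ker i)`. [folklore] -/
theorem base_mem_singImage {s : S.X} (hs : ¬ IsRegularLocalRing (S.X.presheaf.stalk s)) :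
    S.i.base s ∈ singImage S.i.ker :=
  ⟨S.i.toImage s, (toImage_apply_eq_iff S.i s _).mpr rfl,
    fun h => hs ((isRegularLocalRing_stalk_image_iff S.i s).mp h)⟩

/-! ## A torus-stable closed set through a point of a closed orbit contains the orbit -/

/-- **If an orbit-generic point `η` specialises to a point of `singImage`, then `η ∈ singImage`.**  On a unit
chart `W a ∋ y`: `𝓘(Sing)(W a)` is homogeneous (res-type-025) and `𝔭(η)` has graded-simple quotient, so the
homogeneous ideal `𝓘(Sing)(W a) + 𝔭(η) ⊇ 𝔭(η)` is `𝔭(η)` — whence `η ∈ V(𝓘(Sing)) = Sing` — or `⊤`, impossible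
inside `𝔭(y) ⊇ 𝓘(Sing)(W a) + 𝔭(η)`. [folklore] -/
theorem mem_singImage_of_isOrbitGeneric_of_specializes {η y : S.Y} (hog : S.IsOrbitGeneric η) (hηy : η ⤳ y)
    (hy : y ∈ singImage S.i.ker) : η ∈ singImage S.i.ker := by
  -- a unit chart through `y`, hence through `η`
  obtain ⟨x, hx⟩ := mem_range_of_mem_singImage S hy
  obtain ⟨a, hxa, ha⟩ := S.exists_isUnitChart x
  have hya : y ∈ (S.atlas.W a : S.Y.Opens) := hx ▸ hxa
  have hηa : η ∈ (S.atlas.W a : S.Y.Opens) := hηy.mem_open (S.atlas.W a : S.Y.Opens).2 hya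
  letI := S.atlas.gradedRing a
  obtain ⟨hhom, hgs⟩ := hog a ha hηa
  -- the homogeneous ideal of the non-regular image on the chart
  let Z : Closeds S.Y := ⟨singImage S.i.ker, isClosed_singSet S.f S.i.ker⟩
  have hZ : ((Scheme.IdealSheafData.vanishingIdeal Z).ideal (S.atlas.W a)).IsHomogeneous (S.atlas.piece a) :=
    vanishingIdeal_singSet_isHomogeneous S.f S.i.ker Z rfl (S.atlas.W a) (S.atlas.piece a)
      (S.atlas.isHomogeneous_ker a)
  set P := ((S.atlas.W a).2.primeIdealOf ⟨η, hηa⟩).asIdeal with hP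
  set I := (Scheme.IdealSheafData.vanishingIdeal Z).ideal (S.atlas.W a) with hI
  have hgs' : ∀ (d : Fin S.j → ℤ) ⦃b : Γ(S.Y, S.atlas.W a)⦄, b ∈ S.atlas.piece a d → b ∉ P →
      IsUnit (Ideal.Quotient.mk P b) := fun d b hb hbP => hgs d b hb hbP
  rcases eq_or_eq_top_of_isHomogeneous_of_gradedSimple (S.atlas.piece a) hgs' (hZ.sup hhom)
      (le_sup_right : P ≤ I ⊔ P) with h | h
  · -- `I ≤ P`: `η` lies in the zero set of `𝓘(Sing)`, i.e. in `Sing`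
    have hIP : I ≤ P := le_sup_left.trans h.le
    have hmem : η ∈ (Z : Set S.Y) ∩ (S.atlas.W a : S.Y.Opens) := by
      rw [closeds_inter_eq_zeroLocus_vanishingIdeal (S.atlas.W a) Z]
      refine ⟨?_, hηa⟩
      rw [Scheme.mem_zeroLocus_iff]
      intro f hf
      rw [mem_basicOpen_iff_not_mem_primeIdealOf (S.atlas.W a) hηa f, not_not]
      exact hIP hf
    exact hmem.1
  · -- `I + P = ⊤` is impossible: both lie in `𝔭(y)`
    exfalso
    have hIy : I ≤ ((S.atlas.W a).2.primeIdealOf ⟨y, hya⟩).asIdeal := by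
      intro f hf
      have hyZ : y ∈ (Z : Set S.Y) ∩ (S.atlas.W a : S.Y.Opens) := ⟨hy, hya⟩
      rw [closeds_inter_eq_zeroLocus_vanishingIdeal (S.atlas.W a) Z, Set.mem_inter_iff,
        Scheme.mem_zeroLocus_iff] at hyZ
      have h1 := hyZ.1 f hf
      rwa [mem_basicOpen_iff_not_mem_primeIdealOf (S.atlas.W a) hya f, not_not] at h1
    have hPy : P ≤ ((S.atlas.W a).2.primeIdealOf ⟨y, hya⟩).asIdeal :=
      primeIdealOf_le_of_mem_closure (S.atlas.W a) hηa hya (specializes_iff_mem_closure.mp hηy)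
    have hle : I ⊔ P ≤ ((S.atlas.W a).2.primeIdealOf ⟨y, hya⟩).asIdeal := sup_le hIy hPy
    rw [h] at hle
    exact ((S.atlas.W a).2.primeIdealOf ⟨y, hya⟩).2.ne_top (top_le_iff.mp hle)

/-! ## (α) an orbit-generic point in the non-regular image -/

/-- **(α) A non-regular stage has an ORBIT-GENERIC point in `singImage`**, indeed a maximal point of the fibre
of `q` over a closed point of `V`: take a closed non-regular point `s` of `X`, `v := q s` (closed), and a maximal
point `η` of the closed fibre `i(q⁻¹{v})` specialising to `i s`; `η` is orbit-generic
(`isOrbitGeneric_of_mem_maxPoints_fibre`) and lies in `singImage`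
(`mem_singImage_of_isOrbitGeneric_of_specializes`). [folklore] -/
theorem exists_isOrbitGeneric_mem_singImage (hreg : ¬ Scheme.IsRegular S.X) :
    ∃ (v : S.V) (η : S.Y), IsClosed ({v} : Set S.V) ∧ η ∈ maxPoints (S.i.base '' (S.q.base ⁻¹' {v})) ∧
      S.IsOrbitGeneric η ∧ η ∈ singImage S.i.ker := by
  obtain ⟨s, hsc, hs⟩ := S.exists_isClosed_not_isRegularLocalRing hreg
  have hvc : IsClosed ({S.q.base s} : Set S.V) := S.isClosed_singleton_q hsc
  have hsF : S.i.base s ∈ S.i.base '' (S.q.base ⁻¹' {S.q.base s}) := ⟨s, rfl, rfl⟩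
  obtain ⟨η, hη, hηs⟩ := exists_mem_maxPoints_specializes (S.isClosed_image_fibre hvc) hsF
  have hog : S.IsOrbitGeneric η := S.isOrbitGeneric_of_mem_maxPoints_fibre hvc hη
  exact ⟨S.q.base s, η, hvc, hη, hog,
    S.mem_singImage_of_isOrbitGeneric_of_specializes hog hηs (S.base_mem_singImage hs)⟩

/-! ## (β) = U6: the ambient stalk at an orbit-generic singular point has dimension `≤ 3` -/

/-- **Under (I0)₂, the closure of an orbit-generic point `η = i x` of `singImage` has dimension `≥ j`**
(`TorusChartDim.le_ringKrullDim_quotient` on a unit chart through `η`). [folklore] -/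
theorem le_height_of_isOrbitGeneric {η : S.Y} (hη : η ∈ singImage S.i.ker) (hog : S.IsOrbitGeneric η) :
    (S.j : ℕ∞) ≤ Order.height η := by
  obtain ⟨x, hx⟩ := mem_range_of_mem_singImage S hη
  obtain ⟨a, hxa, ha⟩ := S.exists_isUnitChart x
  have hηa : η ∈ (S.atlas.W a : S.Y.Opens) := hx ▸ hxa
  letI := S.atlas.gradedRing a
  obtain ⟨hhom, -⟩ := hog a ha hηa
  have hle := TorusChartDim.le_ringKrullDim_quotient (S.atlas.piece a)
    ((S.atlas.W a).2.primeIdealOf ⟨η, hηa⟩).asIdeal hhom ((S.atlas.W a).2.primeIdealOf ⟨η, hηa⟩).2.ne_top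
    (Nat.pos_iff_ne_zero.mp S.atlas.exponent_pos)
    (fun i => S.exists_isUnit_quotient_of_isUnitChart ha hηa ⟨x, hx⟩ (Pi.single i 1))
  rw [← Literature.AlgebraicGeometry.Dimension.Scheme.height_eq_ringKrullDim_quotient_primeIdealOf S.f
    (S.atlas.W a).2 hηa] at hle
  exact_mod_cast hle

/-- **Under (I0)₂, `dim 𝒪_{X,x} ≤ 2` at an orbit-generic point `i x` of `singImage`** (`coheight x + height x
= dim X = j + 2`, `height x = height (i x) ≥ j`). [folklore] -/
theorem ringKrullDim_stalk_X_le_two_of_isOrbitGeneric (h0 : S.InvDim₂) {x : S.X}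
    (hη : S.i.base x ∈ singImage S.i.ker) (hog : S.IsOrbitGeneric (S.i.base x)) :
    ringKrullDim (S.X.presheaf.stalk x) ≤ ((2 : ℕ) : WithBot ℕ∞) := by
  have hsum := Literature.AlgebraicGeometry.Dimension.coheight_add_height_eq_topologicalKrullDim
    (S.i ≫ S.f) x
  rw [h0] at hsum
  have hh : (S.j : ℕ∞) ≤ Order.height x := by
    rw [← Literature.AlgebraicGeometry.Motives.Scheme.height_base_eq_of_isClosedImmersion S.i x]
    exact S.le_height_of_isOrbitGeneric hη hog
  have h1 : Order.coheight x + Order.height x = ((S.j + 2 : ℕ) : ℕ∞) := by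
    rw [← WithBot.coe_natCast, WithBot.coe_inj] at hsum
    exact hsum
  have h2 : Order.coheight x + (S.j : ℕ∞) ≤ 2 + (S.j : ℕ∞) := by
    calc Order.coheight x + (S.j : ℕ∞) ≤ Order.coheight x + Order.height x := add_le_add le_rfl hh
      _ = ((S.j + 2 : ℕ) : ℕ∞) := h1
      _ = 2 + (S.j : ℕ∞) := by push_cast; ring
  have hco : Order.coheight x ≤ 2 := (ENat.add_le_add_iff_right (ENat.coe_ne_top S.j)).mp h2
  rw [ringKrullDim_stalk_eq_coheight]
  have h3 : ((Order.coheight x : ℕ∞) : WithBot ℕ∞) ≤ ((2 : ℕ∞) : WithBot ℕ∞) := WithBot.coe_le_coe.mpr hco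
  exact h3.trans_eq (by norm_cast)

/-- **(β) = U6: under (I0)₂ the ambient local ring at an orbit-generic point of `singImage` has dimension
`≤ 3`** (`𝒪_{Y,η}` is a regular local domain, `𝒪_{Y,η}/(g) ≅ 𝒪_{X,x}` for the local equation `g ≠ 0`, so
`dim 𝒪_{Y,η} = dim 𝒪_{X,x} + 1 ≤ 3`; the rung-1 pattern of `invReg_of_invDim`). [folklore] -/
theorem ringKrullDim_stalk_le_three_of_isOrbitGeneric (h0 : S.InvDim₂) {η : S.Y}
    (hη : η ∈ singImage S.i.ker) (hog : S.IsOrbitGeneric η) :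
    ringKrullDim (S.Y.presheaf.stalk η) ≤ ((3 : ℕ) : WithBot ℕ∞) := by
  haveI : IsLocallyNoetherian S.Y := LocallyOfFiniteType.isLocallyNoetherian S.f
  have hYreg : Scheme.IsRegular S.Y := Scheme.IsRegular.of_smooth S.f (Scheme.isRegular_Spec (.of k))
  haveI hreg : IsRegularLocalRing (S.Y.presheaf.stalk η) := hYreg η
  obtain ⟨x, hx⟩ := mem_range_of_mem_singImage S hη
  subst hx
  -- `𝒪_{Y,η} ⧸ (ker i)_η ≅ 𝒪_{X,x}` has dimension `≤ 2`
  have hker : stalkIdeal S.i.ker (S.i.base x) = RingHom.ker (S.i.stalkMap x).hom :=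
    stalkIdeal_ker_eq_ker_stalkMap S.i x
  have e : (S.Y.presheaf.stalk (S.i.base x) ⧸ stalkIdeal S.i.ker (S.i.base x)) ≃+*
      S.X.presheaf.stalk x :=
    (Ideal.quotEquivOfEq hker).trans
      (RingHom.quotientKerEquivOfSurjective (S.i.stalkMap_surjective x))
  have hdimq : ringKrullDim (S.Y.presheaf.stalk (S.i.base x) ⧸ stalkIdeal S.i.ker (S.i.base x)) ≤
      ((2 : ℕ) : WithBot ℕ∞) := by
    rw [ringKrullDim_eq_of_ringEquiv e]
    exact S.ringKrullDim_stalk_X_le_two_of_isOrbitGeneric h0 hη hog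
  -- the local equation: a non-zero prime of the regular domain `𝒪_{Y,η}`
  haveI : IsIntegral S.i.ker.subscheme := Literature.AlgebraicGeometry.Motives.isIntegral_image_of_isIntegral S.i
  have hspan : stalkIdeal S.i.ker (S.i.base x) = Ideal.span {localGenerator S.i.ker (S.i.base x)} :=
    stalkIdeal_eq_span_localGenerator S.i.ker (S.i.base x)
      (S.isLocallyPrincipal (S.i.base x)).isPrincipal_stalkIdeal.principal
  have hprime : Prime (localGenerator S.i.ker (S.i.base x)) :=
    prime_localGenerator_of_mem_singImage S.i.ker S.isLocallyPrincipal hη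
  haveI := isDomain_of_isRegularLocalRing (S.Y.presheaf.stalk (S.i.base x))
  have hreg' : localGenerator S.i.ker (S.i.base x) ∈ nonZeroDivisors (S.Y.presheaf.stalk (S.i.base x)) :=
    mem_nonZeroDivisors_of_ne_zero hprime.ne_zero
  have hmax : localGenerator S.i.ker (S.i.base x) ∈ maximalIdeal (S.Y.presheaf.stalk (S.i.base x)) := by
    have h := (mem_support_iff_stalkIdeal_le S.i.ker (S.i.base x)).mp (mem_support_of_mem_singImage S.i.ker hη)
    rw [hspan] at h
    exact h (Ideal.mem_span_singleton_self _)
  -- `dim 𝒪_{Y,η} = dim 𝒪_{Y,η}/(g) + 1 ≤ 3`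
  have hkey := ringKrullDim_quotient_span_singleton_succ_eq_ringKrullDim_of_mem_nonZeroDivisors hreg' hmax
  rw [← hspan] at hkey
  rw [← hkey]
  calc ringKrullDim (S.Y.presheaf.stalk (S.i.base x) ⧸ stalkIdeal S.i.ker (S.i.base x)) + 1
      ≤ ((2 : ℕ) : WithBot ℕ∞) + 1 := add_le_add hdimq le_rfl
    _ = ((3 : ℕ) : WithBot ℕ∞) := by norm_cast

/-! ## `genSing₂` is non-empty -/

/-- **On a non-regular stage with (I0)₂ the set `genSing₂` of orbit-generic non-regular points with ambient
stalk of dimension `≤ 3` is NON-EMPTY** — the first half of (C-a) `E2MaxNonemptyBody`. [folklore] -/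
theorem genSing₂_nonempty (h0 : S.InvDim₂) (hreg : ¬ Scheme.IsRegular S.X) : S.genSing₂.Nonempty := by
  obtain ⟨-, η, -, -, hog, hη⟩ := S.exists_isOrbitGeneric_mem_singImage hreg
  exact ⟨η, hη, hog, S.ringKrullDim_stalk_le_three_of_isOrbitGeneric h0 hη hog⟩

end Summit.ResolutionOfSingularities.ResolutionOfSingularities.Theorems.ELadderOne.Stage

end
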